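import Summits.QuantumFields.YangMills.Theorems.BalabanUVNodesN06CurrentMajAtPinsPhys
import Literature.MathematicalPhysics.QuantumFieldTheory.Balaban1983to89.B9Eq3117NormClausesFromIdentity
import Literature.MathematicalPhysics.QuantumFieldTheory.Balaban1983to89.Node00.OpsYEq3117Identity

/-!
# BalabanUVNodes ∕ N06 ([B9], `Dag.B9_main`) — THE CURRENT LETTERS `hBJ` OF THE STAGE-11 CERTIFICATE FROM ONE DISPLAYED IDENTITY: print's (3.117)
# «`(Δ(U)D_Uλ)(b) = (i∕2)[J(b), λ(b₋) + R(U_b)λ(b₊)]`» at node00-def-Y's letters (+ regularity at every fine bond + the pins); and its STEP-3 face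

Track A of `YM-PLAN.md` (cell `pub-ymgap`, HUMAN RULING D-0062), node **N06** = [Balaban1985BackgroundPropagators] Thms 3.1–3.15; WIDTH-209, seat
`pub-ymgap-dag-n06-w8` (g4), INTENT-14, 2026-08-28.  Sequel of `…N06CurrentMajAtPinsPhys` (F18: `hBJ` from the two norm clauses `h3117g ∕ h3117d`) and of the
Literature module `B9Eq3117NormClausesFromIdentity` (F19: the clauses from the identity, the transposed one through «D* is the adjoint of D», «Δ hermitian»).
WHAT.  ★★ `hBJ_of_identity3117` — the certificate's binder `hBJ` (editions ≥ 23; `…V6EPairNT` :158) VERBATIM from ONE displayed binder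
`h3117 : ∀ x, M ≤ M_x → ∀ α₀ > 0, M_xα₀ ≤ a → ∀ U, Reg335 → Reg336 → ∀ Λ f, hessGradY x.toKIdx U Λ f = (i∕2)·(JY … U f·M − M·JY … U f)`,
`M = Λ(f₋) + R(U_f)Λ(f₊)`, plus the displayed
`hreg` (F8 ∕ F10 shape) and the pins `hbI0 hβ1 hblk12 hblkW12`; numerics `0 ≤ cJ`, `cJ·a ≤ 1`, `0 ≤ δB`, `tJ ≥ 2(d+1)·(ℓ+1)³·N·(10⁴(d+1)·cJ)·e^{3δB}` (the clause
constants are `k₃ = 1` and `N`; `N` serves both).  ★★ `hBJ_of_identity3117_P` — the STEP-3 (α) face (premises `(bg9YP …).Reg335∕336 c α₀ U`, `c ≤ 10`; `hreg`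
DISCHARGED by F12; `10(ℓ+1)⁷·a ≤ 1`).
★★★ `hBJ_of_pins` — THE IDENTITY DISCHARGED: node00-def-Y's `Node00.OpsYEq3117Identity.hessGradY_eq_comm_JY` (p644867 ✓: (3.117) IS A THEOREM at def-Y's letters for
every configuration, hypothesis `0 < c_f` only — true at every member, `MemberY.hcfk : c_f = L^k`) makes `h3117` a theorem, so the binder `hBJ` follows from the displayed
`hreg` + the pins + the numerics ALONE; ★★★ `hBJ_of_pins_P` — at print's cube class (STEP 3) from the PINS AND NUMERICS ALONE (no analytic hypothesis left: (3.117) by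
def-Y, (3.36) ⟹ regularity at every bond by F12, the [4]-(2.51) bookkeeping by F17).  KNIT RECIPE (dag-n06-d): `have hBJ := N06CurrentMajAtPinsIdPhys.hBJ_of_pins
(N := N) H 𝔬12 bI hbI0 hβ1 hblk12 hblkW12 cJ tJ δB M12 a12 hcJ ha1 hδB htJ hreg` (editions at `bg9Y`'s class); at STEP 3 `hBJ_of_pins_P (N := N) H c hc10 𝔬12 bI hbI0 hβ1
hblk12 hblkW12 tJ δB M a ha1 hδB htJ`.
HONEST FRAMING.  Composition of F17 ∕ F18 ∕ F19 with def-Y's identity and F12 (kernel bookkeeping); the W-b road of the N06 width table is CLOSED for the binder `hBJ`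
(modulo the displayed `hreg` at the small-cube class, a theorem at print's class); COUNT-NEUTRAL; nothing of [B9]'s ANALYSIS beyond these finite-lattice identities asserted;
N06 NOT discharged; K1⁷∕K1⁹ NOT closed; no summit statement is proved — one finite 𝕋⁴ programme at fixed `ε`: NOT continuum, NOT OS, NOT the mass gap ∕ Clay.
0 `def`, 0 `sorry`.
-/

noncomputable section

namespace Summit.QuantumFields.YangMills.BalabanUVNodes.N06CurrentMajAtPinsIdPhys

open Literature.MathematicalPhysics.QuantumFieldTheory.Balaban1983to89
open Literature.MathematicalPhysics.QuantumFieldTheory.Balaban1983to89.Node00 (CfgY SiteY FBondY IBondY JY Stage3Params etaBY)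
open Literature.MathematicalPhysics.QuantumFieldTheory.Balaban1983to89.B9Eq39Adjoint (R)
open Literature.MathematicalPhysics.QuantumFieldTheory.Balaban1983to89.B9PerturbationMajorantAlgebra (CurrentMaj)
open Literature.MathematicalPhysics.QuantumFieldTheory.Balaban1983to89.B9PerturbationMajorantsAtLetters (BcoKH BdcoKH)
open Literature.MathematicalPhysics.QuantumFieldTheory.Balaban1983to89.B9PerturbationSplitAtLetters (hessGradY divHessY)
open Literature.MathematicalPhysics.QuantumFieldTheory.Balaban1983to89.B9PinMembersKLevelV1 (MemberY geo9Y bg9Y)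
open Literature.MathematicalPhysics.QuantumFieldTheory.Balaban1983to89.B9BackgroundsKLevelV1P (bg9YP mem_of_reg335P reg335YP_iff)
open Literature.MathematicalPhysics.QuantumFieldTheory.Balaban1983to89.B9PinGeometryKLevelV1 (c35Y)
open Literature.MathematicalPhysics.QuantumFieldTheory.Balaban1983to89.B7Prop2SpecialUnitary (specialUnitaryUnits specialUnitaryUnits_le_unitaryUnits
  specialUnitaryUnits_le_U1)
open Literature.MathematicalPhysics.QuantumFieldTheory.Balaban1983to89.B9CoReadingCoords (XBK blkBK)
open Literature.MathematicalPhysics.QuantumFieldTheory.Balaban1983to89.B9CoReadingCoordsH (XHK)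
open Literature.MathematicalPhysics.QuantumFieldTheory.Balaban1983to89.B9CoReadingCoordsS (XSK blkSK sIK)
open Literature.MathematicalPhysics.QuantumFieldTheory.Balaban1983to89.B9CoReadingCoordsTranspose (TrIdx trBasis)
open Literature.MathematicalPhysics.QuantumFieldTheory.Balaban1983to89.B9Eq336CurrentBound (RegularAt)
open Literature.MathematicalPhysics.QuantumFieldTheory.Balaban1983to89.B9BackgroundsKLevelV1 (shiftsV1)
open Literature.MathematicalPhysics.QuantumFieldTheory.Balaban1983to89.B6GlobalChartV1 (PV blkV1 boxEquiv)
open Literature.MathematicalPhysics.QuantumFieldTheory.Balaban1983to89.B6Ineq2142KLevelV1 (β)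
open Literature.MathematicalPhysics.QuantumFieldTheory.Balaban1983to89.B6Geom246MultiLevelTorus (geomT)
open Literature.MathematicalPhysics.QuantumFieldTheory.Balaban1983to89.B9Eq3117NormClausesFromIdentity (hg_of_identity_I hdh_of_identity_I unitary_of_reg335)
open Summit.QuantumFields.YangMills.BalabanUVNodes.N06CurrentMajAtPinsPhys (hBJ_of_letters3117 hBJ_of_letters3117_P)
open Literature.MathematicalPhysics.QuantumFieldTheory.Balaban1983to89.Node00.OpsYEq3117Identity (hessGradY_eq_comm_JY)
open scoped Matrix.Norms.L2Operator

variable {N : ℕ} [NeZero N] {θ : Stage3Params} {Mstar : ℕ}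
variable [∀ x : MemberY θ.d₆ θ.ℓ₆ θ.hd' θ.hL' θ.b₀ θ.b₁ Mstar, Fintype (geo9Y x).Site]

/-- ★★ **THE CERTIFICATE's BINDER `hBJ` FROM ONE DISPLAYED (3.117) IDENTITY + REGULARITY AT EVERY FINE BOND + THE PINS** (module docstring).
[cite: Balaban1985BackgroundPropagators, (3.117) p.419, (3.8) p.392, (3.10) p.392, (3.36) p.396, p.422; Balaban1984PropagatorsII, (2.51) p.232] -/
theorem hBJ_of_identity3117 (H : MemberY θ.d₆ θ.ℓ₆ θ.hd' θ.hL' θ.b₀ θ.b₁ Mstar → Prop)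
    (𝔬12 : ∀ x : MemberY θ.d₆ θ.ℓ₆ θ.hd' θ.hL' θ.b₀ θ.b₁ Mstar, B9Thm312Whole.Ops (geo9Y x) (bg9Y (Matrix (Fin N) (Fin N) ℂ) (specialUnitaryUnits (Fin N)) x)
      (XBK (TrIdx N) x.toKIdx) (XBK (TrIdx N) x.toKIdx) (XHK (TrIdx N) x.toKIdx) (XSK (TrIdx N) x.toKIdx))
    (bI : ∀ x : MemberY θ.d₆ θ.ℓ₆ θ.hd' θ.hL' θ.b₀ θ.b₁ Mstar, FBondY x.toKIdx → IBondY x.toKIdx)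
    (hbI0 : ∀ (x : MemberY θ.d₆ θ.ℓ₆ θ.hd' θ.hL' θ.b₀ θ.b₁ Mstar) (f : FBondY x.toKIdx), bI x f = bI x ⟨f.src, 0⟩)
    (hβ1 : ∀ (x : MemberY θ.d₆ θ.ℓ₆ θ.hd' θ.hL' θ.b₀ θ.b₁ Mstar) (f : FBondY x.toKIdx), (geomT x.D).dist (β x.hN x.D x.hk (bI x f)) (blkV1 x.hN x.D f) ≤ 1)
    (hblk12 : ∀ x : MemberY θ.d₆ θ.ℓ₆ θ.hd' θ.hL' θ.b₀ θ.b₁ Mstar, (𝔬12 x).blk = blkBK x.toKIdx (bI x))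
    (hblkW12 : ∀ x : MemberY θ.d₆ θ.ℓ₆ θ.hd' θ.hL' θ.b₀ θ.b₁ Mstar, (𝔬12 x).blkW = blkSK x.toKIdx (sIK x.toKIdx (bI x)))
    (cJ tJ δB M a : ℝ) (hcJ : 0 ≤ cJ) (ha1 : cJ * a ≤ 1) (hδB : 0 ≤ δB)
    (htJ : 2 * ((θ.d₆ : ℝ) + 1) * (((θ.ℓ₆ + 1 : ℕ) : ℝ)) ^ 3 * (N : ℝ) * (10 ^ 4 * ((θ.d₆ : ℝ) + 1) * cJ) * Real.exp (3 * δB) ≤ tJ)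
    (h3117 : ∀ x : MemberY θ.d₆ θ.ℓ₆ θ.hd' θ.hL' θ.b₀ θ.b₁ Mstar, M ≤ (geo9Y x).M → ∀ α₀ : ℝ, 0 < α₀ → (geo9Y x).M * α₀ ≤ a →
      ∀ U : (bg9Y (Matrix (Fin N) (Fin N) ℂ) (specialUnitaryUnits (Fin N)) x).Cfg,
        (bg9Y (Matrix (Fin N) (Fin N) ℂ) (specialUnitaryUnits (Fin N)) x).Reg335 c35Y α₀ U →
        (bg9Y (Matrix (Fin N) (Fin N) ℂ) (specialUnitaryUnits (Fin N)) x).Reg336 c35Y α₀ U →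
          ∀ (Λ : SiteY x.toKIdx → Matrix (Fin N) (Fin N) ℂ) (f : FBondY x.toKIdx), hessGradY x.toKIdx U Λ f =
            (Complex.I / 2) • (JY x.toKIdx U f * (Λ (boxEquiv x.hN f.src) + R (U f.dir f.src) (Λ (boxEquiv x.hN f.tgt))) -
              (Λ (boxEquiv x.hN f.src) + R (U f.dir f.src) (Λ (boxEquiv x.hN f.tgt))) * JY x.toKIdx U f))
    (hreg : ∀ x : MemberY θ.d₆ θ.ℓ₆ θ.hd' θ.hL' θ.b₀ θ.b₁ Mstar, M ≤ (geo9Y x).M → ∀ α₀ : ℝ, 0 < α₀ → (geo9Y x).M * α₀ ≤ a →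
      ∀ U : (bg9Y (Matrix (Fin N) (Fin N) ℂ) (specialUnitaryUnits (Fin N)) x).Cfg,
        (bg9Y (Matrix (Fin N) (Fin N) ℂ) (specialUnitaryUnits (Fin N)) x).Reg335 c35Y α₀ U →
        (bg9Y (Matrix (Fin N) (Fin N) ℂ) (specialUnitaryUnits (Fin N)) x).Reg336 c35Y α₀ U →
          ∀ μ s, RegularAt (shiftsV1 (PV θ.d₆ θ.ℓ₆ x.toKIdx.m x.toKIdx.K θ.hd' θ.hL')) U (etaBY x.toKIdx)
            (cJ * ((geo9Y x).M * α₀)) ((geo9Y x).len (bI x ⟨s, 0⟩)) μ s) :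
    ∀ x : MemberY θ.d₆ θ.ℓ₆ θ.hd' θ.hL' θ.b₀ θ.b₁ Mstar, M ≤ (geo9Y x).M → ∀ α₀ : ℝ, 0 < α₀ → (geo9Y x).M * α₀ ≤ a →
      ∀ U : (bg9Y (Matrix (Fin N) (Fin N) ℂ) (specialUnitaryUnits (Fin N)) x).Cfg,
        (bg9Y (Matrix (Fin N) (Fin N) ℂ) (specialUnitaryUnits (Fin N)) x).Reg335 c35Y α₀ U →
        (bg9Y (Matrix (Fin N) (Fin N) ℂ) (specialUnitaryUnits (Fin N)) x).Reg336 c35Y α₀ U →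
          CurrentMaj (𝔬12 x).blkW (𝔬12 x).blk
            (BcoKH x.toKIdx (trBasis N) (bg9Y (Matrix (Fin N) (Fin N) ℂ) (specialUnitaryUnits (Fin N)) x) (fun U => U) U)
            (BdcoKH x.toKIdx (trBasis N) (bg9Y (Matrix (Fin N) (Fin N) ℂ) (specialUnitaryUnits (Fin N)) x) (fun U => U) U) 1 (H x)
            (tJ * ((geo9Y x).M * α₀)) δB := by
  have hN1 : (1 : ℝ) ≤ (N : ℝ) := by exact_mod_cast Nat.one_le_iff_ne_zero.mpr (NeZero.ne N)
  refine hBJ_of_letters3117 H 𝔬12 bI hbI0 hβ1 hblk12 hblkW12 (N : ℝ) cJ tJ δB M a (Nat.cast_nonneg N) hcJ ha1 hδB htJ ?_ ?_ hreg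
  · intro x hM α₀ hα ha U hU hU' Λ f
    have h := hg_of_identity_I x.toKIdx (fun μ s => (unitary_of_reg335 x hU μ s).2) (h3117 x hM α₀ hα ha U hU hU') Λ f
    exact h.trans (mul_le_mul_of_nonneg_right (mul_le_mul_of_nonneg_right hN1 (norm_nonneg _)) (by positivity))
  · intro x hM α₀ hα ha U hU hU' A s
    have h := hdh_of_identity_I x.toKIdx U (fun μ z => (unitary_of_reg335 x hU μ z).1) (fun μ z => (unitary_of_reg335 x hU μ z).2)
      (h3117 x hM α₀ hα ha U hU hU') A s
    simpa only [mul_one] using h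

/-- ★★ **THE STEP-3 (α) FACE**: `hBJ` at print's cube class from the ONE displayed identity — objects over `bg9Y`, premises LITERALLY `(bg9YP …).Reg335∕336 c α₀ U`
(`c ≤ 10`); regularity at every fine bond is F12's THEOREM (`c_J := 10(ℓ+1)⁷`, so `10(ℓ+1)⁷·a ≤ 1` and
`tJ ≥ 2(d+1)(ℓ+1)³·N·(10⁴(d+1)·10(ℓ+1)⁷)·e^{3δB}`). [cite: Balaban1985BackgroundPropagators, (3.117) p.419, (3.35)–(3.36) p.396, p.422; Balaban1984PropagatorsII, (2.51) p.232, (2.2) p.224] -/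
theorem hBJ_of_identity3117_P (H : MemberY θ.d₆ θ.ℓ₆ θ.hd' θ.hL' θ.b₀ θ.b₁ Mstar → Prop) (c : ℝ) (hc10 : c ≤ 10)
    (𝔬12 : ∀ x : MemberY θ.d₆ θ.ℓ₆ θ.hd' θ.hL' θ.b₀ θ.b₁ Mstar, B9Thm312Whole.Ops (geo9Y x) (bg9Y (Matrix (Fin N) (Fin N) ℂ) (specialUnitaryUnits (Fin N)) x)
      (XBK (TrIdx N) x.toKIdx) (XBK (TrIdx N) x.toKIdx) (XHK (TrIdx N) x.toKIdx) (XSK (TrIdx N) x.toKIdx))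
    (bI : ∀ x : MemberY θ.d₆ θ.ℓ₆ θ.hd' θ.hL' θ.b₀ θ.b₁ Mstar, FBondY x.toKIdx → IBondY x.toKIdx)
    (hbI0 : ∀ (x : MemberY θ.d₆ θ.ℓ₆ θ.hd' θ.hL' θ.b₀ θ.b₁ Mstar) (f : FBondY x.toKIdx), bI x f = bI x ⟨f.src, 0⟩)
    (hβ1 : ∀ (x : MemberY θ.d₆ θ.ℓ₆ θ.hd' θ.hL' θ.b₀ θ.b₁ Mstar) (f : FBondY x.toKIdx), (geomT x.D).dist (β x.hN x.D x.hk (bI x f)) (blkV1 x.hN x.D f) ≤ 1)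
    (hblk12 : ∀ x : MemberY θ.d₆ θ.ℓ₆ θ.hd' θ.hL' θ.b₀ θ.b₁ Mstar, (𝔬12 x).blk = blkBK x.toKIdx (bI x))
    (hblkW12 : ∀ x : MemberY θ.d₆ θ.ℓ₆ θ.hd' θ.hL' θ.b₀ θ.b₁ Mstar, (𝔬12 x).blkW = blkSK x.toKIdx (sIK x.toKIdx (bI x)))
    (tJ δB M a : ℝ) (ha1 : 10 * ((θ.ℓ₆ + 1 : ℕ) : ℝ) ^ 7 * a ≤ 1) (hδB : 0 ≤ δB)
    (htJ : 2 * ((θ.d₆ : ℝ) + 1) * (((θ.ℓ₆ + 1 : ℕ) : ℝ)) ^ 3 * (N : ℝ) * (10 ^ 4 * ((θ.d₆ : ℝ) + 1) * (10 * ((θ.ℓ₆ + 1 : ℕ) : ℝ) ^ 7)) *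
      Real.exp (3 * δB) ≤ tJ)
    (h3117 : ∀ x : MemberY θ.d₆ θ.ℓ₆ θ.hd' θ.hL' θ.b₀ θ.b₁ Mstar, M ≤ (geo9Y x).M → ∀ α₀ : ℝ, 0 < α₀ → (geo9Y x).M * α₀ ≤ a →
      ∀ U : (bg9Y (Matrix (Fin N) (Fin N) ℂ) (specialUnitaryUnits (Fin N)) x).Cfg,
        (bg9YP (Matrix (Fin N) (Fin N) ℂ) (specialUnitaryUnits (Fin N)) x).Reg335 c α₀ U →
        (bg9YP (Matrix (Fin N) (Fin N) ℂ) (specialUnitaryUnits (Fin N)) x).Reg336 c α₀ U →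
          ∀ (Λ : SiteY x.toKIdx → Matrix (Fin N) (Fin N) ℂ) (f : FBondY x.toKIdx), hessGradY x.toKIdx U Λ f =
            (Complex.I / 2) • (JY x.toKIdx U f * (Λ (boxEquiv x.hN f.src) + R (U f.dir f.src) (Λ (boxEquiv x.hN f.tgt))) -
              (Λ (boxEquiv x.hN f.src) + R (U f.dir f.src) (Λ (boxEquiv x.hN f.tgt))) * JY x.toKIdx U f)) :
    ∀ x : MemberY θ.d₆ θ.ℓ₆ θ.hd' θ.hL' θ.b₀ θ.b₁ Mstar, M ≤ (geo9Y x).M → ∀ α₀ : ℝ, 0 < α₀ → (geo9Y x).M * α₀ ≤ a →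
      ∀ U : (bg9Y (Matrix (Fin N) (Fin N) ℂ) (specialUnitaryUnits (Fin N)) x).Cfg,
        (bg9YP (Matrix (Fin N) (Fin N) ℂ) (specialUnitaryUnits (Fin N)) x).Reg335 c α₀ U →
        (bg9YP (Matrix (Fin N) (Fin N) ℂ) (specialUnitaryUnits (Fin N)) x).Reg336 c α₀ U →
          CurrentMaj (𝔬12 x).blkW (𝔬12 x).blk
            (BcoKH x.toKIdx (trBasis N) (bg9Y (Matrix (Fin N) (Fin N) ℂ) (specialUnitaryUnits (Fin N)) x) (fun U => U) U)
            (BdcoKH x.toKIdx (trBasis N) (bg9Y (Matrix (Fin N) (Fin N) ℂ) (specialUnitaryUnits (Fin N)) x) (fun U => U) U) 1 (H x)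
            (tJ * ((geo9Y x).M * α₀)) δB := by
  have hN1 : (1 : ℝ) ≤ (N : ℝ) := by exact_mod_cast Nat.one_le_iff_ne_zero.mpr (NeZero.ne N)
  -- at print's class a (3.35)-regular configuration is `SU(N)`-valued as well
  have hGv : ∀ (x : MemberY θ.d₆ θ.ℓ₆ θ.hd' θ.hL' θ.b₀ θ.b₁ Mstar) {α₀ : ℝ} {U : (bg9Y (Matrix (Fin N) (Fin N) ℂ) (specialUnitaryUnits (Fin N)) x).Cfg},
      (bg9YP (Matrix (Fin N) (Fin N) ℂ) (specialUnitaryUnits (Fin N)) x).Reg335 c α₀ U → ∀ μ s, U μ s ∈ specialUnitaryUnits (Fin N) :=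
    fun x α₀ U hU μ s => mem_of_reg335P x.toKIdx ((reg335YP_iff x c α₀ U).1 hU).1 μ s
  refine hBJ_of_letters3117_P H c hc10 𝔬12 bI hbI0 hβ1 hblk12 hblkW12 (N : ℝ) tJ δB M a (Nat.cast_nonneg N) ha1 hδB htJ ?_ ?_
  · intro x hM α₀ hα ha U hU hU' Λ f
    have h := hg_of_identity_I x.toKIdx (fun μ s => specialUnitaryUnits_le_U1 (hGv x hU μ s)) (h3117 x hM α₀ hα ha U hU hU') Λ f
    exact h.trans (mul_le_mul_of_nonneg_right (mul_le_mul_of_nonneg_right hN1 (norm_nonneg _)) (by positivity))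
  · intro x hM α₀ hα ha U hU hU' A s
    have h := hdh_of_identity_I x.toKIdx U (fun μ z => specialUnitaryUnits_le_unitaryUnits (hGv x hU μ z))
      (fun μ z => specialUnitaryUnits_le_U1 (hGv x hU μ z)) (h3117 x hM α₀ hα ha U hU hU') A s
    simpa only [mul_one] using h

omit [∀ x : MemberY θ.d₆ θ.ℓ₆ θ.hd' θ.hL' θ.b₀ θ.b₁ Mstar, Fintype (geo9Y x).Site] in
/-- at a member the bond-sector scale factor is `c_f = L^k > 0` (`MemberY.hcfk`) — the one hypothesis of node00-def-Y's (3.117) theorem.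
[cite: Balaban1985BackgroundPropagators, (3.3) p.390 (the factor η⁻¹ = L^k), bookkeeping] -/
theorem cf_pos (x : MemberY θ.d₆ θ.ℓ₆ θ.hd' θ.hL' θ.b₀ θ.b₁ Mstar) : 0 < x.toKIdx.cf := by
  have h : x.toKIdx.cf = (((θ.ℓ₆ + 1 : ℕ) : ℝ)) ^ x.toKIdx.k := x.hcfk
  rw [h]; positivity

/-- ★★★ **THE CERTIFICATE's BINDER `hBJ` WITH (3.117) DISCHARGED** (node00-def-Y `hessGradY_eq_comm_JY`): from the displayed regularity at every fine bond `hreg`,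
the pins `hbI0 hβ1 hblk12 hblkW12` and the numerics `0 ≤ cJ`, `cJ·a ≤ 1`, `0 ≤ δB`, `tJ ≥ 2(d+1)(ℓ+1)³·N·(10⁴(d+1)cJ)·e^{3δB}` ALONE.
[cite: Balaban1985BackgroundPropagators, (3.117) p.419, (3.36) p.396, p.422; Balaban1984PropagatorsII, (2.51) p.232] -/
theorem hBJ_of_pins (H : MemberY θ.d₆ θ.ℓ₆ θ.hd' θ.hL' θ.b₀ θ.b₁ Mstar → Prop)
    (𝔬12 : ∀ x : MemberY θ.d₆ θ.ℓ₆ θ.hd' θ.hL' θ.b₀ θ.b₁ Mstar, B9Thm312Whole.Ops (geo9Y x) (bg9Y (Matrix (Fin N) (Fin N) ℂ) (specialUnitaryUnits (Fin N)) x)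
      (XBK (TrIdx N) x.toKIdx) (XBK (TrIdx N) x.toKIdx) (XHK (TrIdx N) x.toKIdx) (XSK (TrIdx N) x.toKIdx))
    (bI : ∀ x : MemberY θ.d₆ θ.ℓ₆ θ.hd' θ.hL' θ.b₀ θ.b₁ Mstar, FBondY x.toKIdx → IBondY x.toKIdx)
    (hbI0 : ∀ (x : MemberY θ.d₆ θ.ℓ₆ θ.hd' θ.hL' θ.b₀ θ.b₁ Mstar) (f : FBondY x.toKIdx), bI x f = bI x ⟨f.src, 0⟩)
    (hβ1 : ∀ (x : MemberY θ.d₆ θ.ℓ₆ θ.hd' θ.hL' θ.b₀ θ.b₁ Mstar) (f : FBondY x.toKIdx), (geomT x.D).dist (β x.hN x.D x.hk (bI x f)) (blkV1 x.hN x.D f) ≤ 1)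
    (hblk12 : ∀ x : MemberY θ.d₆ θ.ℓ₆ θ.hd' θ.hL' θ.b₀ θ.b₁ Mstar, (𝔬12 x).blk = blkBK x.toKIdx (bI x))
    (hblkW12 : ∀ x : MemberY θ.d₆ θ.ℓ₆ θ.hd' θ.hL' θ.b₀ θ.b₁ Mstar, (𝔬12 x).blkW = blkSK x.toKIdx (sIK x.toKIdx (bI x)))
    (cJ tJ δB M a : ℝ) (hcJ : 0 ≤ cJ) (ha1 : cJ * a ≤ 1) (hδB : 0 ≤ δB)
    (htJ : 2 * ((θ.d₆ : ℝ) + 1) * (((θ.ℓ₆ + 1 : ℕ) : ℝ)) ^ 3 * (N : ℝ) * (10 ^ 4 * ((θ.d₆ : ℝ) + 1) * cJ) * Real.exp (3 * δB) ≤ tJ)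
    (hreg : ∀ x : MemberY θ.d₆ θ.ℓ₆ θ.hd' θ.hL' θ.b₀ θ.b₁ Mstar, M ≤ (geo9Y x).M → ∀ α₀ : ℝ, 0 < α₀ → (geo9Y x).M * α₀ ≤ a →
      ∀ U : (bg9Y (Matrix (Fin N) (Fin N) ℂ) (specialUnitaryUnits (Fin N)) x).Cfg,
        (bg9Y (Matrix (Fin N) (Fin N) ℂ) (specialUnitaryUnits (Fin N)) x).Reg335 c35Y α₀ U →
        (bg9Y (Matrix (Fin N) (Fin N) ℂ) (specialUnitaryUnits (Fin N)) x).Reg336 c35Y α₀ U →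
          ∀ μ s, RegularAt (shiftsV1 (PV θ.d₆ θ.ℓ₆ x.toKIdx.m x.toKIdx.K θ.hd' θ.hL')) U (etaBY x.toKIdx)
            (cJ * ((geo9Y x).M * α₀)) ((geo9Y x).len (bI x ⟨s, 0⟩)) μ s) :
    ∀ x : MemberY θ.d₆ θ.ℓ₆ θ.hd' θ.hL' θ.b₀ θ.b₁ Mstar, M ≤ (geo9Y x).M → ∀ α₀ : ℝ, 0 < α₀ → (geo9Y x).M * α₀ ≤ a →
      ∀ U : (bg9Y (Matrix (Fin N) (Fin N) ℂ) (specialUnitaryUnits (Fin N)) x).Cfg,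
        (bg9Y (Matrix (Fin N) (Fin N) ℂ) (specialUnitaryUnits (Fin N)) x).Reg335 c35Y α₀ U →
        (bg9Y (Matrix (Fin N) (Fin N) ℂ) (specialUnitaryUnits (Fin N)) x).Reg336 c35Y α₀ U →
          CurrentMaj (𝔬12 x).blkW (𝔬12 x).blk
            (BcoKH x.toKIdx (trBasis N) (bg9Y (Matrix (Fin N) (Fin N) ℂ) (specialUnitaryUnits (Fin N)) x) (fun U => U) U)
            (BdcoKH x.toKIdx (trBasis N) (bg9Y (Matrix (Fin N) (Fin N) ℂ) (specialUnitaryUnits (Fin N)) x) (fun U => U) U) 1 (H x)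
            (tJ * ((geo9Y x).M * α₀)) δB :=
  hBJ_of_identity3117 H 𝔬12 bI hbI0 hβ1 hblk12 hblkW12 cJ tJ δB M a hcJ ha1 hδB htJ
    (fun x _ _ _ _ U _ _ Λ f => hessGradY_eq_comm_JY x.toKIdx (cf_pos x) U Λ f) hreg

/-- ★★★ **`hBJ` AT PRINT's CUBE CLASS FROM THE PINS AND NUMERICS ALONE** (STEP 3): (3.117) by node00-def-Y's theorem, regularity at every bond by F12's
`regularAt_pinScale_of_regYP336` ((3.36) over print's cube class), the majorant bookkeeping by F17 — no analytic hypothesis left; premises LITERALLY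
`(bg9YP …).Reg335∕336 c α₀ U`, `c ≤ 10`; `10(ℓ+1)⁷·a ≤ 1`, `tJ ≥ 2(d+1)(ℓ+1)³·N·(10⁴(d+1)·10(ℓ+1)⁷)·e^{3δB}`.
[cite: Balaban1985BackgroundPropagators, (3.117) p.419, (3.35)–(3.36) p.396, p.422; Balaban1984PropagatorsII, (2.51) p.232, (2.2) p.224] -/
theorem hBJ_of_pins_P (H : MemberY θ.d₆ θ.ℓ₆ θ.hd' θ.hL' θ.b₀ θ.b₁ Mstar → Prop) (c : ℝ) (hc10 : c ≤ 10)
    (𝔬12 : ∀ x : MemberY θ.d₆ θ.ℓ₆ θ.hd' θ.hL' θ.b₀ θ.b₁ Mstar, B9Thm312Whole.Ops (geo9Y x) (bg9Y (Matrix (Fin N) (Fin N) ℂ) (specialUnitaryUnits (Fin N)) x)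
      (XBK (TrIdx N) x.toKIdx) (XBK (TrIdx N) x.toKIdx) (XHK (TrIdx N) x.toKIdx) (XSK (TrIdx N) x.toKIdx))
    (bI : ∀ x : MemberY θ.d₆ θ.ℓ₆ θ.hd' θ.hL' θ.b₀ θ.b₁ Mstar, FBondY x.toKIdx → IBondY x.toKIdx)
    (hbI0 : ∀ (x : MemberY θ.d₆ θ.ℓ₆ θ.hd' θ.hL' θ.b₀ θ.b₁ Mstar) (f : FBondY x.toKIdx), bI x f = bI x ⟨f.src, 0⟩)
    (hβ1 : ∀ (x : MemberY θ.d₆ θ.ℓ₆ θ.hd' θ.hL' θ.b₀ θ.b₁ Mstar) (f : FBondY x.toKIdx), (geomT x.D).dist (β x.hN x.D x.hk (bI x f)) (blkV1 x.hN x.D f) ≤ 1)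
    (hblk12 : ∀ x : MemberY θ.d₆ θ.ℓ₆ θ.hd' θ.hL' θ.b₀ θ.b₁ Mstar, (𝔬12 x).blk = blkBK x.toKIdx (bI x))
    (hblkW12 : ∀ x : MemberY θ.d₆ θ.ℓ₆ θ.hd' θ.hL' θ.b₀ θ.b₁ Mstar, (𝔬12 x).blkW = blkSK x.toKIdx (sIK x.toKIdx (bI x)))
    (tJ δB M a : ℝ) (ha1 : 10 * ((θ.ℓ₆ + 1 : ℕ) : ℝ) ^ 7 * a ≤ 1) (hδB : 0 ≤ δB)
    (htJ : 2 * ((θ.d₆ : ℝ) + 1) * (((θ.ℓ₆ + 1 : ℕ) : ℝ)) ^ 3 * (N : ℝ) * (10 ^ 4 * ((θ.d₆ : ℝ) + 1) * (10 * ((θ.ℓ₆ + 1 : ℕ) : ℝ) ^ 7)) *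
      Real.exp (3 * δB) ≤ tJ) :
    ∀ x : MemberY θ.d₆ θ.ℓ₆ θ.hd' θ.hL' θ.b₀ θ.b₁ Mstar, M ≤ (geo9Y x).M → ∀ α₀ : ℝ, 0 < α₀ → (geo9Y x).M * α₀ ≤ a →
      ∀ U : (bg9Y (Matrix (Fin N) (Fin N) ℂ) (specialUnitaryUnits (Fin N)) x).Cfg,
        (bg9YP (Matrix (Fin N) (Fin N) ℂ) (specialUnitaryUnits (Fin N)) x).Reg335 c α₀ U →
        (bg9YP (Matrix (Fin N) (Fin N) ℂ) (specialUnitaryUnits (Fin N)) x).Reg336 c α₀ U →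
          CurrentMaj (𝔬12 x).blkW (𝔬12 x).blk
            (BcoKH x.toKIdx (trBasis N) (bg9Y (Matrix (Fin N) (Fin N) ℂ) (specialUnitaryUnits (Fin N)) x) (fun U => U) U)
            (BdcoKH x.toKIdx (trBasis N) (bg9Y (Matrix (Fin N) (Fin N) ℂ) (specialUnitaryUnits (Fin N)) x) (fun U => U) U) 1 (H x)
            (tJ * ((geo9Y x).M * α₀)) δB :=
  hBJ_of_identity3117_P H c hc10 𝔬12 bI hbI0 hβ1 hblk12 hblkW12 tJ δB M a ha1 hδB htJ
    (fun x _ _ _ _ U _ _ Λ f => hessGradY_eq_comm_JY x.toKIdx (cf_pos x) U Λ f)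

end Summit.QuantumFields.YangMills.BalabanUVNodes.N06CurrentMajAtPinsIdPhys

end
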